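import Literature.MathematicalPhysics.QuantumManyBody.BoseGasWallCutoff
import Literature.Analysis.Calculus.CutoffDataEnergy
import HarnessLib

/-!
# A `C¹` plateau on `[0, L]` and the truncated sine profile

Topic `Literature/MathematicalPhysics/QuantumManyBody`, namespace `…BoseGas`; elementary real
analysis over the explicit `C¹` wall profile of `BoseGasWallCutoff.lean`
(`WallCutoff.exists_wallProfile`).  For `L ≥ 4`:

* `exists_plateau` — a `C¹` function `p : ℝ → [0,1]` with `p = 0` on `(-∞, 1] ∪ [L-1, ∞)`,
  `p = 1` on `[2, L-2]`, `|p'| ≤ π`, and `p' = 0` off the ramps `[1,2] ∪ (L-2, L-1]`;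
* `sineProfile_*` — properties of the truncated sine `g₀(t) = sin(πt/L) p(t)`: it is `C¹` on `ℝ`
  with compact support in `[1, L-1] ⊂ (0, L)` (no gluing is needed: the plateau kills the sine
  before the ends of the box), `g₀² ≥ 1_{[2,L-2]} sin²(π·/L)`, and
  `g₀'² ≤ (1+η)(π/L)² 1_{[0,L]} cos²(π·/L) + (1+η⁻¹)(4π⁴/L²) 1_{ramps}` pointwise for every `η > 0`
  (Young's `(a+b)² ≤ (1+η)a² + (1+η⁻¹)b²` from `Literature/Analysis/Calculus/CutoffDataEnergy.lean`,
  `|sin(πt/L)| ≤ 2π/L` on the ramps).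

These are the pointwise inputs of the near-optimal free Dirichlet trial state (Rayleigh quotient
`≤ (π/L)²(1 + o(1))` as `L → ∞`); the integrations are done in the companion file.  No
definitions (the profile is obtained existentially and the sine written out).

## References

* [LSSY2005] E. H. Lieb, R. Seiringer, J. P. Solovej, J. Yngvason, *The Mathematics of the Bose
  Gas and its Condensation* (2005), Ch. 2 (2.3) (the Dirichlet box level `π²/L²` per coordinate).
-/

noncomputable section

namespace Literature.MathematicalPhysics.QuantumManyBody.BoseGas

open _root_.MeasureTheory _root_.Filter _root_.Set _root_.Real
open scoped Topology

/-! ### An elementary lemma -/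

/-- A function that is constant on an open half-line has zero derivative there. [folklore] -/
theorem deriv_eq_zero_of_eqOn {f : ℝ → ℝ} {s : Set ℝ} {c t : ℝ} (hs : s ∈ 𝓝 t)
    (h : EqOn f (fun _ => c) s) : deriv f t = 0 := by
  rw [(Filter.eventuallyEq_of_mem hs h).deriv_eq]; simp

/-! ### The plateau -/

/-- **A `C¹` plateau.**  For every `L` (of interest: `L ≥ 4`) there is a `C¹` function `p : ℝ → [0,1]` with `p = 0` on
`(-∞, 1]` and on `[L-1, ∞)`, `p = 1` on `[2, L-2]`, `|p'| ≤ π` everywhere, and `p' = 0` off the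
ramps `[1, 2] ∪ (L-2, L-1]`: the product of a rising and a falling wall profile. [folklore] -/
theorem exists_plateau (L : ℝ) :
    ∃ p : ℝ → ℝ, ContDiff ℝ 1 p ∧ (∀ t, 0 ≤ p t ∧ p t ≤ 1) ∧ (∀ t, t ≤ 1 → p t = 0) ∧
      (∀ t, L - 1 ≤ t → p t = 0) ∧ (∀ t ∈ Icc 2 (L - 2), p t = 1) ∧ (∀ t, |deriv p t| ≤ π) ∧
      (∀ t, deriv p t ≠ 0 → t ∈ Icc 1 2 ∪ Ioc (L - 2) (L - 1)) := by
  -- falling profile at `[L-2, L-1]`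
  obtain ⟨θd, hθd, hd01, hdder, hdnz, hdone, hdzero⟩ :=
    WallCutoff.exists_wallProfile (L := L) (w := 1) one_pos
  simp only [mul_one] at hdder hdnz hdone hdzero
  -- rising profile at `[1, 2]`: one minus a falling profile of the box `[0, 3]`
  obtain ⟨θt, hθt, ht01, htder, htnz, htone, htzero⟩ :=
    WallCutoff.exists_wallProfile (L := 3) (w := 1) one_pos
  norm_num at htder htnz htone htzero
  set θu : ℝ → ℝ := fun t => 1 - θt t with hθu_def
  have hθu : ContDiff ℝ 1 θu := contDiff_const.sub hθt
  have hθu_apply : ∀ t, θu t = 1 - θt t := fun t => rfl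
  have hθu_der : ∀ t, deriv θu t = -deriv θt t := fun t =>
    ((hθt.differentiable one_ne_zero t).hasDerivAt.const_sub 1).deriv
  have hθu01 : ∀ t, 0 ≤ θu t ∧ θu t ≤ 1 := fun t => by
    obtain ⟨h1, h2⟩ := ht01 t; rw [hθu_apply]; exact ⟨by linarith, by linarith⟩
  -- locally constant pieces have zero derivative
  have hθt_der_gt : ∀ t, 2 < t → deriv θt t = 0 := fun t ht =>
    deriv_eq_zero_of_eqOn (Ioi_mem_nhds ht) fun u hu => htzero u (le_of_lt hu)
  have hθt_der_lt : ∀ t, t < 1 → deriv θt t = 0 := fun t ht =>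
    deriv_eq_zero_of_eqOn (Iio_mem_nhds ht) fun u hu => htone u (le_of_lt hu)
  have hθd_der_gt : ∀ t, L - 1 < t → deriv θd t = 0 := fun t ht =>
    deriv_eq_zero_of_eqOn (Ioi_mem_nhds ht) fun u hu => hdzero u (le_of_lt hu)
  have hθd_der_le : ∀ t, t ≤ L - 2 → deriv θd t = 0 := by
    intro t ht; by_contra h; exact absurd (hdnz t h) (not_lt.2 ht)
  have hderiv : ∀ t, deriv (fun t => θu t * θd t) t = deriv θu t * θd t + θu t * deriv θd t := fun t =>
    ((hθu.differentiable one_ne_zero t).hasDerivAt.mul (hθd.differentiable one_ne_zero t).hasDerivAt).deriv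
  -- the plateau
  refine ⟨fun t => θu t * θd t, hθu.mul hθd, fun t => ?_, fun t ht => ?_, fun t ht => ?_,
    fun t ht => ?_, fun t => ?_, fun t hne => ?_⟩
  · obtain ⟨h1, h2⟩ := hθu01 t; obtain ⟨h3, h4⟩ := hd01 t
    exact ⟨mul_nonneg h1 h3, by nlinarith⟩
  · show θu t * θd t = 0
    rw [hθu_apply, htone t ht]; ring
  · show θu t * θd t = 0
    rw [hdzero t ht]; ring
  · show θu t * θd t = 1
    rw [hθu_apply, htzero t ht.1, hdone t ht.2]; ring
  · rw [hderiv, hθu_der]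
    obtain ⟨h1, h2⟩ := hθu01 t; obtain ⟨h3, h4⟩ := hd01 t
    have ha : |(-deriv θt t) * θd t| ≤ π / 2 := by
      rw [abs_mul, abs_neg, abs_of_nonneg h3]
      calc |deriv θt t| * θd t ≤ (π / 2) * 1 := mul_le_mul (htder t) h4 h3 (by positivity)
        _ = π / 2 := mul_one _
    have hb : |θu t * deriv θd t| ≤ π / 2 := by
      rw [abs_mul, abs_of_nonneg h1]
      calc θu t * |deriv θd t| ≤ 1 * (π / 2) := mul_le_mul h2 (hdder t) (abs_nonneg _) zero_le_one
        _ = π / 2 := one_mul _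
    calc |(-deriv θt t) * θd t + θu t * deriv θd t| ≤ |(-deriv θt t) * θd t| + |θu t * deriv θd t| :=
          abs_add_le _ _
      _ ≤ π / 2 + π / 2 := add_le_add ha hb
      _ = π := by ring
  · rw [hderiv, hθu_der] at hne
    by_contra hmem
    simp only [Set.mem_union, Set.mem_Icc, Set.mem_Ioc, not_or, not_and_or, not_le, not_lt] at hmem
    obtain ⟨hA, hB⟩ := hmem
    apply hne
    -- off the ramps both terms vanish
    have hu0 : deriv θt t = 0 ∨ θd t = 0 := by
      rcases hA with h | h
      · exact Or.inl (hθt_der_lt t h)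
      · rcases hB with h' | h'
        · exact Or.inl (hθt_der_gt t h)
        · exact Or.inr (hdzero t h'.le)
    have hd0 : deriv θd t = 0 := by
      rcases hB with h' | h'
      · exact hθd_der_le t h'
      · exact hθd_der_gt t h'
    rcases hu0 with h | h <;> simp [h, hd0]

/-! ### The truncated sine -/

section Sine

variable {L : ℝ} {p : ℝ → ℝ}

/-- The truncated sine `sin(π·/L) p` is `C¹`. [folklore] -/
theorem contDiff_sineProfile (hp : ContDiff ℝ 1 p) (L : ℝ) :
    ContDiff ℝ 1 fun t => Real.sin (π * t / L) * p t :=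
  (Real.contDiff_sin.comp (by fun_prop)).mul hp

/-- Its derivative. [folklore] -/
theorem hasDerivAt_sineProfile (hp : ContDiff ℝ 1 p) (L t : ℝ) :
    HasDerivAt (fun t => Real.sin (π * t / L) * p t)
      (π / L * Real.cos (π * t / L) * p t + Real.sin (π * t / L) * deriv p t) t := by
  have h1 : HasDerivAt (fun t => Real.sin (π * t / L)) (Real.cos (π * t / L) * (π / L)) t := by
    have hlin : HasDerivAt (fun t : ℝ => π * t / L) (π / L) t := by
      simpa using ((hasDerivAt_id t).const_mul π).div_const L
    exact (Real.hasDerivAt_sin _).comp t hlin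
  have h := h1.mul (hp.differentiable one_ne_zero t).hasDerivAt
  refine h.congr_deriv ?_
  ring

/-- It vanishes off `(0, L)` (indeed off `(1, L-1)`) when `p = 0` on `(-∞,1] ∪ [L-1,∞)`. [folklore] -/
theorem sineProfile_eq_zero (hp1 : ∀ t, t ≤ 1 → p t = 0) (hp2 : ∀ t, L - 1 ≤ t → p t = 0)
    {t : ℝ} (ht : t ∉ Ioo 1 (L - 1)) : Real.sin (π * t / L) * p t = 0 := by
  rw [Set.mem_Ioo, not_and_or, not_lt, not_lt] at ht
  rcases ht with h | h
  · rw [hp1 t h, mul_zero]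
  · rw [hp2 t h, mul_zero]

/-- It has compact support. [folklore] -/
theorem hasCompactSupport_sineProfile (hp1 : ∀ t, t ≤ 1 → p t = 0)
    (hp2 : ∀ t, L - 1 ≤ t → p t = 0) :
    HasCompactSupport fun t => Real.sin (π * t / L) * p t :=
  HasCompactSupport.intro isCompact_Icc fun _ ht =>
    sineProfile_eq_zero hp1 hp2 fun h => ht (Ioo_subset_Icc_self h)

/-- **Lower bound on the square**: `g₀² ≥ 1_{[2, L-2]} sin²(π·/L)`. [folklore] -/
theorem indicator_sin_sq_le_sineProfile_sq (hpone : ∀ t ∈ Icc 2 (L - 2), p t = 1) (t : ℝ) :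
    (Icc 2 (L - 2)).indicator (fun t => Real.sin (π * t / L) ^ 2) t ≤
      (Real.sin (π * t / L) * p t) ^ 2 := by
  by_cases ht : t ∈ Icc 2 (L - 2)
  · rw [indicator_of_mem ht, hpone t ht, mul_one]
  · rw [indicator_of_notMem ht]; positivity

/-- On the ramps the sine is small: `|sin(πt/L)| ≤ 2π/L` for `t ∈ [1,2] ∪ (L-2, L-1]`, `L ≥ 4`.
[folklore] -/
theorem abs_sin_le_of_mem_ramps (hL : 4 ≤ L) {t : ℝ} (ht : t ∈ Icc 1 2 ∪ Ioc (L - 2) (L - 1)) :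
    |Real.sin (π * t / L)| ≤ 2 * π / L := by
  have hL0 : 0 < L := by linarith
  rcases ht with h | h
  · have h0 : 0 ≤ π * t / L := by have := h.1; positivity
    rw [abs_of_nonneg (Real.sin_nonneg_of_nonneg_of_le_pi h0 (by
      rw [div_le_iff₀ hL0]; nlinarith [h.2, Real.pi_pos]))]
    calc Real.sin (π * t / L) ≤ π * t / L := Real.sin_le h0
      _ ≤ 2 * π / L := by rw [div_le_div_iff_of_pos_right hL0]; nlinarith [h.2, Real.pi_pos]
  · have h0 : 0 ≤ π * (L - t) / L := by have := h.2; apply div_nonneg _ hL0.le; nlinarith [Real.pi_pos]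
    have h1 : Real.sin (π * t / L) = Real.sin (π * (L - t) / L) := by
      rw [show π * (L - t) / L = π - π * t / L by rw [mul_sub, sub_div, mul_div_cancel_right₀ _ hL0.ne'],
        Real.sin_pi_sub]
    rw [h1, abs_of_nonneg (Real.sin_nonneg_of_nonneg_of_le_pi h0 (by
      rw [div_le_iff₀ hL0]; nlinarith [h.1, Real.pi_pos]))]
    calc Real.sin (π * (L - t) / L) ≤ π * (L - t) / L := Real.sin_le h0
      _ ≤ 2 * π / L := by rw [div_le_div_iff_of_pos_right hL0]; nlinarith [h.1, Real.pi_pos]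

/-- **Upper bound on the derivative square**: for `η > 0`, pointwise
`g₀'² ≤ (1+η)(π/L)² 1_{[0,L]} cos²(π·/L) + (1+η⁻¹)(4π⁴/L²) 1_{[1,2] ∪ (L-2,L-1]}`. [folklore] -/
theorem deriv_sineProfile_sq_le (hL : 4 ≤ L) (hp : ContDiff ℝ 1 p) (hp01 : ∀ t, 0 ≤ p t ∧ p t ≤ 1)
    (hp1 : ∀ t, t ≤ 1 → p t = 0) (hp2 : ∀ t, L - 1 ≤ t → p t = 0)
    (hpder : ∀ t, |deriv p t| ≤ π) (hpnz : ∀ t, deriv p t ≠ 0 → t ∈ Icc 1 2 ∪ Ioc (L - 2) (L - 1))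
    {η : ℝ} (hη : 0 < η) (t : ℝ) :
    deriv (fun t => Real.sin (π * t / L) * p t) t ^ 2 ≤
      (1 + η) * ((π / L) ^ 2 * (Icc 0 L).indicator (fun t => Real.cos (π * t / L) ^ 2) t) +
        (1 + η⁻¹) * ((Icc 1 2 ∪ Ioc (L - 2) (L - 1)).indicator (fun _ => 4 * π ^ 4 / L ^ 2) t) := by
  have hL0 : 0 < L := by linarith
  rw [(hasDerivAt_sineProfile hp L t).deriv]
  refine (Literature.Analysis.Calculus.add_sq_le_weighted hη _ _).trans (add_le_add ?_ ?_)
  · refine mul_le_mul_of_nonneg_left ?_ (by positivity)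
    by_cases ht : t ∈ Icc 0 L
    · rw [indicator_of_mem ht]
      obtain ⟨h0, h1⟩ := hp01 t
      calc (π / L * Real.cos (π * t / L) * p t) ^ 2 = (π / L) ^ 2 * Real.cos (π * t / L) ^ 2 * p t ^ 2 := by ring
        _ ≤ (π / L) ^ 2 * Real.cos (π * t / L) ^ 2 * 1 := by
            refine mul_le_mul_of_nonneg_left ?_ (by positivity); nlinarith
        _ = _ := mul_one _
    · rw [indicator_of_notMem ht, mul_zero]
      have hpt : p t = 0 := by
        rw [Set.mem_Icc, not_and_or, not_le, not_le] at ht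
        rcases ht with h | h
        · exact hp1 t (by linarith)
        · exact hp2 t (by linarith)
      rw [hpt]; simp
  · refine mul_le_mul_of_nonneg_left ?_ (by positivity)
    by_cases hd : deriv p t = 0
    · rw [hd]; simp only [mul_zero, zero_pow two_ne_zero]
      exact Set.indicator_nonneg (fun _ _ => by positivity) _
    · have hmem := hpnz t hd
      rw [indicator_of_mem hmem]
      have hs := abs_sin_le_of_mem_ramps hL hmem
      have hpd := hpder t
      calc (Real.sin (π * t / L) * deriv p t) ^ 2 = |Real.sin (π * t / L)| ^ 2 * |deriv p t| ^ 2 := by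
            rw [sq_abs, sq_abs]; ring
        _ ≤ (2 * π / L) ^ 2 * π ^ 2 :=
            mul_le_mul (pow_le_pow_left₀ (abs_nonneg _) hs 2) (pow_le_pow_left₀ (abs_nonneg _) hpd 2)
              (by positivity) (by positivity)
        _ = 4 * π ^ 4 / L ^ 2 := by field_simp; ring

end Sine

end Literature.MathematicalPhysics.QuantumManyBody.BoseGas

end
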